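import Summits.NavierStokesRegularity.NavierStokesRegularity.Theorems.ScenarioCensusRowD9Dissipation
import HarnessLib

/-!
# Census row D9 TYPED — part 8/9: S0 the modulated steady limit, §6e first half — zoom identity, slice estimates, the
# window arithmetic (`μ = λ⁻²`, mean value theorem ⇒ dilation ratio → 1 uniformly on the backward windows)

Re-homed for the scenario census (typer seat ns-census-typer-1 g7; in scope of the census KEY text «one `def Row_<k> : Prop`
per OPEN row» — row D9 was the one OPEN-NO-LINE row without a typed tree decl, typer-1 g6 HANDOFF 19:50Z; lead programme ended
at v1.67, base SUMMON-only; ANNOUNCE on the cell STATUS 2026-08-28T20:24Z): VERBATIM PORT of ns-idea-9 LINE 16 «modulation_gate»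
rev 5, `pub/ideators/ns-idea-9/lines/modulation_gate/modulation_gate.lean` sha16 1d7b2cd493e504e0 (2259 l., lean check rc 0,
0 sorry; critic idea-crit-8 V66/V67/V69 PASS-WITH-PRICE on rev 1–4, ref ns-census-ref g8 PRE-CHECK ✓ §13.14 [5/6] of rev 4
f704279be2039922; rev 5 = rev 4 + §6e «S0 proved»; TARGET-MENU r4 names this line as row D9's lever; CENSUS-FINAL r6 §2 lists
`row_F4bp_of_row_D9K` / `row_F4bpLH_of_row_D9LH` as FILES-ONLY edges), split for the 400-line rule into
`ScenarioCensusRowD9Modulation` (§1–§4) → `…RowD9Kernel` (§5) → `…RowD9PowerLaw` (§6) → `…RowD9CoreExponents` (§6c (i)–(iv)) →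
`…RowD9Core` (§6c (v)) → `…RowD9DissipationTools` (§6d, first half) → `…RowD9Dissipation` (§6d, second half) →
`…RowD9SteadyLimitTools` (§6e, first half) → `…RowD9` (§6e, second half; §7; census KEYS).  Lean text VERBATIM in namespace
`…Theorems.ScenarioCensus.ModulationGate` (the line's `…Cruxes.Row_F4bp.ModulationGate` re-homed); port edits: the two
`local notation "E3"` lines → `abbrev E3` (typer lint: no notation in port files), `@[conjecture]` added to the four OPEN
parameterless `def`s `Row_D9K` / `Row_D9LH` / `Row_D9LHWild` / `Row_F4bpLH` (obligation nodes), one-line docstrings added to twelve undocumented auxiliaries, the three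
`@[deprecated] stub_*` aliases of §7 not re-declared, four §7 docstrings updated to the rev-5 facts (everything proved); the two VERBATIM
re-statements of `CoreProof.eLpNorm_zoom` inside `DissipationProof` / `SteadyLimitProof` are not re-declared (gate lint `dedup.landed`) — their two
uses name `CoreProof.eLpNorm_zoom` (proof-only diffs).

No census value is asserted here (a summoned lead books row D9; FILES-ONLY edges become TREE by name); NS regularity is NOT
proved; rows D9 / F4b′ stay OPEN (= their wild residuals, by theorem); no summit statement is proved by this file.
-/

-- the summit and its single problem share the name `NavierStokesRegularity` (D-0017 nested layout)
set_option linter.dupNamespace false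

noncomputable section

open Set Function Filter Topology MeasureTheory Metric
open scoped NNReal ENNReal ContDiff

namespace Summit.NavierStokesRegularity.NavierStokesRegularity.Theorems.ScenarioCensus.ModulationGate

open Literature.Analysis Literature.Analysis.FluidPDE
open Summit.NavierStokesRegularity.NavierStokesRegularity.Theorems.ScenarioCensus

/-! ## §6e (rev 5) S0 IS A THEOREM: the modulated steady limit, PROVED (sorry-free).  Port of the tree's
`typeII_profile_ae_eq_steadyClassicalNS` (Chae 2010 Thm 1.4, «V̄ is a stationary solution») to stationary
modulations: windows `(t₀ − μ(t₀), t₀)`, `μ = λ⁻²`; the mean value theorem (`|μ(t) − μ(t₀)| ≤ sup|μ′|·μ(t₀)`)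
gives the dilation ratio `λ(t)/λ(t₀) → 1` uniformly on the window; strong continuity of dilations; then the
tree's generic limit theorems `integral_veryWeak_eq_zero_of_tendsto`, `isWeaklyDivFree_of_tendsto_eLpNorm_sub`,
`steady_veryWeak_of_const_slab`, `exists_steadyClassicalNS_ae_eq_of_veryWeak` BY NAME. -/

namespace SteadyLimitProof

open TopologicalSpace
open scoped RealInnerProductSpace Laplacian
open Literature.Analysis.FunctionSpaces

/-- `ℝ³` (the line's `local notation "E3"`, spelled as a reducible abbreviation for the tree). -/
abbrev E3 := EuclideanSpace ℝ (Fin 3)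

-- `eLpNorm_zoom`: the line restates `CoreProof.eLpNorm_zoom` here verbatim; the tree takes it BY NAME (gate lint dedup.landed).

/-- **(S0-b) the modulated deviation IS `‖λ⁻¹v(t)(λ⁻¹·) − V̄‖_p`** (for `λ(t) > 0`). -/
theorem modulatedDeviation_eq_eLpNorm_sub {lam : ℝ → ℝ} {p : ℝ≥0}
    {v : ℝ → E3 → E3} {V : E3 → E3} (hV : AEStronglyMeasurable V volume) {t : ℝ} (hlt : 0 < lam t)
    (hvt : AEStronglyMeasurable (v t) volume) :
    modulatedDeviation lam p v V t =
      eLpNorm (fun y => (lam t)⁻¹ • v t ((lam t)⁻¹ • y) - V y) (p : ℝ≥0∞) volume := by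
  have hl0 : lam t ≠ 0 := hlt.ne'
  have hgm : AEStronglyMeasurable (fun x => v t x - lam t • V (lam t • x)) volume :=
    hvt.sub ((hV.comp_quasiMeasurePreserving
      (Literature.Analysis.OperatorTheory.quasiMeasurePreserving_smul' hl0)).const_smul (lam t))
  have hfun : (fun y => (lam t)⁻¹ • v t ((lam t)⁻¹ • y) - V y) =
      (fun y => (lam t)⁻¹ • (fun x => v t x - lam t • V (lam t • x)) ((lam t)⁻¹ • y)) := by
    funext y
    simp only [smul_sub, smul_smul, inv_mul_cancel₀ hl0, mul_inv_cancel₀ hl0, one_smul]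
  rw [hfun, CoreProof.eLpNorm_zoom ENNReal.coe_ne_top hgm hlt]
  unfold modulatedDeviation
  rw [ENNReal.coe_toReal]

/-- **(S0-c) the slice identity**: the slice at `s` of the rescaling `w(s,y) = c v(t₀ + c²s, cy)` is the
NS-dilate by `μ = cλ(t)` of the zoomed field `λ(t)⁻¹ v(t)(λ(t)⁻¹·)`, `t = t₀ + c²s`. -/
theorem nsRescale_slice_eq {v : ℝ → E3 → E3} {lam : ℝ → ℝ} {c t₀ s : ℝ}
    (hl : lam (t₀ + c ^ 2 * s) ≠ 0) :
    FluidPDE.nsRescale c (fun τ x => v (t₀ + τ) x) s =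
      nsRescaleData (c * lam (t₀ + c ^ 2 * s)) fun y =>
        (lam (t₀ + c ^ 2 * s))⁻¹ • v (t₀ + c ^ 2 * s) ((lam (t₀ + c ^ 2 * s))⁻¹ • y) := by
  funext y
  simp only [nsRescale_apply, nsRescaleData_apply, smul_smul]
  congr 1
  · field_simp
  · congr 1
    rw [show (lam (t₀ + c ^ 2 * s))⁻¹ * (c * lam (t₀ + c ^ 2 * s)) = c by field_simp]

/-- **(S0-d) the slice estimate**: `‖w(s) − V̄‖_p ≤ μ^{1−3/p}·modulatedDeviation(t) + ‖D_μV̄ − V̄‖_p`,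
`μ = cλ(t)`, `t = t₀ + c²s ∈ (0,T)`, `λ(t) > 0`. -/
theorem eLpNorm_slice_sub_le {T : ℝ} {p : ℝ≥0} {v : ℝ → E3 → E3} {π : ℝ → E3 → ℝ} {V : E3 → E3}
    {lam : ℝ → ℝ} (hv : IsClassicalNSSolutionOn (Ioo 0 T) 1 0 v π)
    (hp1 : 1 ≤ p) (hV : MemLp V (p : ℝ≥0∞) volume) {c t₀ s : ℝ} (hc : 0 < c)
    (ht0 : 0 < t₀ + c ^ 2 * s) (htT : t₀ + c ^ 2 * s < T) (hlt : 0 < lam (t₀ + c ^ 2 * s)) :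
    eLpNorm (fun y => FluidPDE.nsRescale c (fun τ x => v (t₀ + τ) x) s y - V y) (p : ℝ≥0∞) volume ≤
      ENNReal.ofReal ((c * lam (t₀ + c ^ 2 * s)) ^ (1 - 3 / (p : ℝ))) *
          modulatedDeviation lam p v V (t₀ + c ^ 2 * s) +
        eLpNorm (nsRescaleData (c * lam (t₀ + c ^ 2 * s)) V - V) (p : ℝ≥0∞) volume := by
  set t : ℝ := t₀ + c ^ 2 * s with ht
  set ℓ : ℝ := (lam t)⁻¹ with hℓ
  have hℓ0 : 0 < ℓ := inv_pos.2 hlt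
  set μ : ℝ := c * lam t with hμ
  have hμ0 : 0 < μ := mul_pos hc hlt
  set G : E3 → E3 := fun y => ℓ • v t (ℓ • y) with hG
  have hp0 : p ≠ 0 := (lt_of_lt_of_le one_pos hp1).ne'
  have hscale : eLpNorm_nsRescaleData (E := E3) (F := E3) :=
    @eLpNorm_nsRescaleData_holds E3 _ _ E3 _ _
  have hvt : Continuous (v t) := (hv.contDiff_velocity ⟨ht0, htT⟩).continuous
  have hdev : modulatedDeviation lam p v V t = eLpNorm (G - V) (p : ℝ≥0∞) volume :=
    modulatedDeviation_eq_eLpNorm_sub hV.1 hlt hvt.aestronglyMeasurable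
  have hslice : FluidPDE.nsRescale c (fun τ x => v (t₀ + τ) x) s = nsRescaleData μ G :=
    nsRescale_slice_eq hlt.ne'
  have hGc : Continuous G := by show Continuous fun y => ℓ • v t (ℓ • y); fun_prop
  have hGV : AEStronglyMeasurable (G - V) volume := hGc.aestronglyMeasurable.sub hV.1
  have hqmp := OperatorTheory.quasiMeasurePreserving_smul' (V := E3) hμ0.ne'
  have hD1 : AEStronglyMeasurable (nsRescaleData μ (G - V)) volume :=
    (hGV.comp_quasiMeasurePreserving hqmp).const_smul μ
  have hD2 : AEStronglyMeasurable (nsRescaleData μ V - V) volume :=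
    ((hV.1.comp_quasiMeasurePreserving hqmp).const_smul μ).sub hV.1
  have hdec : (fun y => FluidPDE.nsRescale c (fun τ x => v (t₀ + τ) x) s y - V y) =
      nsRescaleData μ (G - V) + (nsRescaleData μ V - V) := by
    rw [hslice]
    funext y
    simp only [Pi.add_apply, Pi.sub_apply, nsRescaleData_apply, smul_sub]
    abel
  rw [hdec]
  calc eLpNorm (nsRescaleData μ (G - V) + (nsRescaleData μ V - V)) (p : ℝ≥0∞) volume
      ≤ eLpNorm (nsRescaleData μ (G - V)) (p : ℝ≥0∞) volume +
          eLpNorm (nsRescaleData μ V - V) (p : ℝ≥0∞) volume :=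
        eLpNorm_add_le hD1 hD2 (by exact_mod_cast hp1)
    _ = ENNReal.ofReal (μ ^ (1 - 3 / (p : ℝ))) * modulatedDeviation lam p v V t +
          eLpNorm (nsRescaleData μ V - V) (p : ℝ≥0∞) volume := by
        congr 1
        have key := hscale (μ := (volume : Measure E3)) (G - V) hμ0
          (p := (p : ℝ≥0∞)) (by exact_mod_cast hp0) ENNReal.coe_ne_top
        rw [finrank_euclideanSpace_fin] at key
        rw [key, hdev]
        norm_num

/-- **(S0-e) the Jacobian factor** `μ^e ≤ 4` for `½ ≤ μ ≤ 2`, `−2 ≤ e ≤ 1`. -/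
theorem rpow_le_four {μ e : ℝ} (h1 : 1 / 2 ≤ μ) (h2 : μ ≤ 2) (he1 : -2 ≤ e) (he2 : e ≤ 1) :
    μ ^ e ≤ 4 := by
  have hμ0 : 0 < μ := by linarith
  rcases le_or_gt 0 e with he | he
  · calc μ ^ e ≤ (2 : ℝ) ^ e := Real.rpow_le_rpow hμ0.le h2 he
      _ ≤ (2 : ℝ) ^ (1 : ℝ) := Real.rpow_le_rpow_of_exponent_le (by norm_num) he2
      _ ≤ 4 := by norm_num
  · have hinv : μ⁻¹ ≤ 2 := by
      rw [inv_le_comm₀ hμ0 (by norm_num)]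
      linarith
    calc μ ^ e = (μ⁻¹) ^ (-e) := by
          rw [Real.inv_rpow hμ0.le, Real.rpow_neg hμ0.le, inv_inv]
      _ ≤ (2 : ℝ) ^ (-e) := Real.rpow_le_rpow (inv_nonneg.2 hμ0.le) hinv (by linarith)
      _ ≤ (2 : ℝ) ^ (2 : ℝ) := Real.rpow_le_rpow_of_exponent_le (by norm_num) (by linarith)
      _ = 4 := by norm_num

/-- `μ = λ⁻²` tends to `0` for a modulation `λ → ∞`. -/
theorem tendsto_inv_sq_of_tendsto_atTop {T : ℝ} {lam : ℝ → ℝ} (hlam : Tendsto lam (𝓝[<] T) atTop) :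
    Tendsto (fun t => ((lam t) ^ 2)⁻¹) (𝓝[<] T) (𝓝 0) := by
  have h2 : Tendsto (fun t => (lam t) ^ 2) (𝓝[<] T) atTop := by
    simpa [sq] using hlam.atTop_mul_atTop₀ hlam
  exact h2.inv_tendsto_atTop

/-- **(S0-f) eventually-good base times**: `0 < c(t₀) = λ(t₀)⁻¹`, `c(t₀)² ≤ t₀`, `t₀ < T`. -/
theorem eventually_window {T : ℝ} (hT : 0 < T) {lam : ℝ → ℝ} (hlam : Tendsto lam (𝓝[<] T) atTop) :
    ∀ᶠ t₀ in 𝓝[<] T, 0 < (lam t₀)⁻¹ ∧ ((lam t₀)⁻¹) ^ 2 ≤ t₀ ∧ t₀ < T := by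
  have hpos : ∀ᶠ t₀ in 𝓝[<] T, 0 < lam t₀ := hlam.eventually (eventually_gt_atTop 0)
  have hltT : ∀ᶠ t₀ in 𝓝[<] T, t₀ < T := eventually_nhdsWithin_of_forall fun t ht => ht
  have hm := tendsto_inv_sq_of_tendsto_atTop hlam
  have hdiff : Tendsto (fun t₀ => t₀ - ((lam t₀) ^ 2)⁻¹) (𝓝[<] T) (𝓝 (T - 0)) :=
    (tendsto_nhdsWithin_of_tendsto_nhds tendsto_id).sub hm
  have hwin : ∀ᶠ t₀ in 𝓝[<] T, 0 < t₀ - ((lam t₀) ^ 2)⁻¹ :=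
    hdiff.eventually (lt_mem_nhds (by simpa using hT))
  filter_upwards [hpos, hltT, hwin] with t₀ h1 h2 h3
  refine ⟨inv_pos.2 h1, ?_, h2⟩
  rw [inv_pow]
  linarith

/-- window arithmetic: `t = t₀ + c²s` with `−1 < s < 0`. -/
theorem window_arith {t₀ c s : ℝ} (hc : 0 < c ^ 2) (hs : s ∈ Ioo (-1 : ℝ) 0) :
    t₀ + c ^ 2 * s < t₀ ∧ t₀ - c ^ 2 < t₀ + c ^ 2 * s ∧ t₀ - (t₀ + c ^ 2 * s) ≤ c ^ 2 := by
  refine ⟨?_, ?_, ?_⟩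
  · nlinarith [hs.2]
  · nlinarith [hs.1]
  · nlinarith [hs.1]

/-- ratio algebra: `|a − b| ≤ κa`, `μ²b = a`, `b > 0` ⇒ `|μ² − 1| ≤ κμ²`. -/
theorem abs_sq_sub_one_le {a b κ μ : ℝ} (hb : 0 < b) (hkey : |a - b| ≤ κ * a) (hμsq : μ ^ 2 * b = a) :
    |μ ^ 2 - 1| ≤ κ * μ ^ 2 := by
  have hA : |μ ^ 2 - 1| * b ≤ (κ * μ ^ 2) * b := by
    calc |μ ^ 2 - 1| * b = |(μ ^ 2 - 1) * b| := by rw [abs_mul, abs_of_pos hb]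
      _ = |a - b| := by rw [sub_mul, one_mul, hμsq]
      _ ≤ κ * a := hkey
      _ = (κ * μ ^ 2) * b := by rw [← hμsq]; ring
  exact le_of_mul_le_mul_right hA hb

/-- `|μ² − 1| ≤ κμ²` with `κ ≤ ⅛`, `μ > 0` ⇒ `|μ − 1| ≤ 2κ`. -/
theorem abs_sub_one_le {κ μ : ℝ} (hμ : 0 < μ) (hκ0 : 0 ≤ κ) (hκ : κ ≤ 1 / 8)
    (hB : |μ ^ 2 - 1| ≤ κ * μ ^ 2) : |μ - 1| ≤ 2 * κ := by
  have h1 : μ ^ 2 - 1 ≤ κ * μ ^ 2 := (le_abs_self _).trans hB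
  have hμsq_le : μ ^ 2 ≤ 2 := by nlinarith
  have hμ2 : |μ ^ 2 - 1| ≤ 2 * κ := hB.trans (by nlinarith)
  have hpos : 0 < μ + 1 := by linarith
  have hfac : |μ ^ 2 - 1| = |μ - 1| * (μ + 1) := by
    rw [show μ ^ 2 - 1 = (μ - 1) * (μ + 1) by ring, abs_mul, abs_of_pos hpos]
  have h2 : |μ - 1| * 1 ≤ |μ - 1| * (μ + 1) :=
    mul_le_mul_of_nonneg_left (by linarith) (abs_nonneg _)
  rw [hfac] at hμ2
  linarith

/-- exponent bounds: `−2 ≤ 1 − 3/p ≤ 1` for `p ≥ 1`. -/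
theorem exponent_bounds {p : ℝ} (hp1 : 1 ≤ p) : -2 ≤ 1 - 3 / p ∧ 1 - 3 / p ≤ 1 := by
  have hp0 : 0 < p := by linarith
  have h3 : 3 / p ≤ 3 := by
    rw [div_le_iff₀ hp0]; nlinarith
  have h0 : 0 ≤ 3 / p := by positivity
  constructor <;> linarith

/-- ratio identity `(a⁻¹b)²·b⁻² = a⁻²`. -/
theorem ratio_sq_identity {a b : ℝ} (ha : a ≠ 0) (hb : b ≠ 0) :
    (a⁻¹ * b) ^ 2 * (b ^ 2)⁻¹ = (a ^ 2)⁻¹ := by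
  field_simp

end SteadyLimitProof

end Summit.NavierStokesRegularity.NavierStokesRegularity.Theorems.ScenarioCensus.ModulationGate

end
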